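import Summits.ValiantsHypothesis.ValiantsHypothesis.Theorems.RigidityForcesSymmetryGrenetFirstOrderRankRigidBlockW0

/-!
# Route RigidityForcesSymmetry — `GrenetFirstOrderRankRigid` (item stmt-ValiantsHypothesis-21029),
line `grenet_gauge`: stub `stub_linearRigid`, step 5 — the lattice-path matrix at WORD POINTS and the
weights read along a word

For the crux line `Cruxes/GrenetFirstOrderRankRigid/Lines/grenet_gauge.lean` (blueprint
`Lines/grenet_gauge-stub_linearRigid-PROOF.md`, §5, blocks W0 and I=).  A WORD is any map
`r : Fin n → Fin n` (column `c` ↦ row `r c`); its 0/1 point is `x_{j,c} := [r c = j]`.  At such a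
point a lattice path survives iff it inserts `r c` at level `c`:
`evalWord_grenet_adj_pow`, `evalWord_grenet_W_empty` (`W ∅ S = [S = r({c<|S|})]`),
`evalWord_grenet_W_univ`.  Counting along a word: `card_filter_eq_of_card_image`,
`colWeight_eq_one_imp` (column weight identically `1` ⇔ `|T| = |S|+1`, `q = |S|`), `weightE_window`
(the entry `(r({c<s}), r({c>s})ᶜ, (r s, s))` read along `r` at a valid split `s` has the indicator
weight `inl j ↦ #{c : r c = j}`, `inr ↦ 1`).  Consumed by `grenet_window_identity` (file `…Windows`).

No new definitions.  VP ≠ VNP is not moved by this file.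
-/

noncomputable section

open MvPolynomial Matrix Finset

namespace Summit.ValiantsHypothesis.Theorems.RigidityForcesSymmetry.GrenetGauge

open Literature.Computability.AlgebraicComplexity

/-! ### Paths inside a word point -/

section WordEval

variable (k : Type*) [CommRing k] {n : ℕ}

/-- The image of the shifted word `t ↦ r (s + t)` (`t < m`, `s + m ≤ n`) is the slice `r({s ≤ c < s+m})`.
[folklore] -/
theorem image_word_shift (r : Fin n → Fin n) {s m : ℕ} (hsm : s + m ≤ n) :
    univ.image (fun t : Fin m => r ⟨s + (t : ℕ), by omega⟩)
      = (univ.filter fun i : Fin n => s ≤ (i : ℕ) ∧ (i : ℕ) < s + m).image r := by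
  ext x
  simp only [Finset.mem_image, Finset.mem_univ, true_and, Finset.mem_filter]
  constructor
  · rintro ⟨t, rfl⟩
    exact ⟨⟨s + (t : ℕ), by omega⟩, ⟨by simp, by simp⟩, rfl⟩
  · rintro ⟨i, ⟨h1, h2⟩, rfl⟩
    exact ⟨⟨(i : ℕ) - s, by omega⟩, by congr 1; ext; simp only; omega⟩

/-- A map out of `Fin m` is injective iff its image has `m` elements. [folklore] -/
theorem injective_iff_card_image_eq {α : Type*} [DecidableEq α] {m : ℕ} (g : Fin m → α) :
    Function.Injective g ↔ (univ.image g).card = m := by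
  rw [← Set.injOn_univ, ← Finset.coe_univ, ← Finset.card_image_iff, Finset.card_univ,
    Fintype.card_fin]

/-- **Powers of the adjacency matrix at a word point.**  At `x_{j,c} := [r c = j]` only the steps
`S → S + r(|S|+t)` survive: for `|S| + m ≤ n`,
`eval ((adj ^ m) S T) = [t ↦ r(|S|+t) injective, avoids S, and S ∪ r({|S| ≤ c < |S|+m}) = T]`.
[folklore] -/
theorem evalWord_grenet_adj_pow (r : Fin n → Fin n) {m : ℕ} (S T : Finset (Fin n))
    (hsm : S.card + m ≤ n) :
    eval (fun v : Fin n × Fin n => if r v.2 = v.1 then (1 : k) else 0) ((Grenet.adj k n ^ m) S T)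
      = if Function.Injective (fun t : Fin m => r ⟨S.card + (t : ℕ), by omega⟩) ∧
            (∀ t : Fin m, r ⟨S.card + (t : ℕ), by omega⟩ ∉ S) ∧
            S ∪ (univ.filter fun i : Fin n => S.card ≤ (i : ℕ) ∧ (i : ℕ) < S.card + m).image r = T
        then 1 else 0 := by
  rw [eval_grenet_adj_pow]
  set g₀ : Fin m → Fin n := fun t => r ⟨S.card + (t : ℕ), by omega⟩ with hg₀
  have hterm : ∀ g : Fin m → Fin n,
      (∏ t : Fin m, eval (fun v : Fin n × Fin n => if r v.2 = v.1 then (1 : k) else 0)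
        (Grenet.wt k n (g t) (S.card + t))) = if g = g₀ then 1 else 0 := by
    intro g
    have h1 : ∀ t : Fin m, eval (fun v : Fin n × Fin n => if r v.2 = v.1 then (1 : k) else 0)
        (Grenet.wt k n (g t) (S.card + t)) = if g₀ t = g t then 1 else 0 := fun t => by
      rw [eval_grenet_wt, dif_pos (by omega)]
    simp_rw [h1]
    rw [Fintype.prod_boole]
    by_cases hg : g = g₀
    · rw [if_pos hg, if_pos fun t => by rw [hg]]
    · rw [if_neg hg, if_neg fun h => hg (funext fun t => (h t).symm)]
  simp_rw [hterm]
  rw [Finset.sum_eq_single_of_mem g₀ (Finset.mem_univ _) fun g _ hg => by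
    rw [if_neg hg]; split_ifs <;> rfl]
  rw [if_pos rfl]
  have himg : univ.image g₀ = (univ.filter fun i : Fin n => S.card ≤ (i : ℕ) ∧ (i : ℕ) < S.card + m).image r :=
    image_word_shift r hsm
  by_cases hc : Function.Injective g₀ ∧ (∀ t : Fin m, r ⟨S.card + (t : ℕ), by omega⟩ ∉ S) ∧
      S ∪ (univ.filter fun i : Fin n => S.card ≤ (i : ℕ) ∧ (i : ℕ) < S.card + m).image r = T
  · rw [if_pos hc, if_pos ⟨hc.1, hc.2.1, by rw [himg]; exact hc.2.2⟩]
  · rw [if_neg hc, if_neg]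
    rintro ⟨h1, h2, h3⟩
    rw [himg] at h3
    exact hc ⟨h1, h2, h3⟩

/-- **The source column of the path matrix at a word point**: `eval (W ∅ S) = [S = r({c < |S|})]`
(injectivity of `r` before `|S|` is then automatic). [folklore] -/
theorem evalWord_grenet_W_empty (r : Fin n → Fin n) (S : Finset (Fin n)) :
    eval (fun v : Fin n × Fin n => if r v.2 = v.1 then (1 : k) else 0) ((1 - Grenet.adj k n).adjugate ∅ S)
      = if (univ.filter fun i : Fin n => (i : ℕ) < S.card).image r = S then 1 else 0 := by
  have hSn : S.card ≤ n := (Finset.card_le_univ S).trans_eq (Fintype.card_fin n)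
  have hfilt : ∀ m : ℕ, (univ.filter fun i : Fin n => (∅ : Finset (Fin n)).card ≤ (i : ℕ) ∧
      (i : ℕ) < (∅ : Finset (Fin n)).card + m) = univ.filter fun i : Fin n => (i : ℕ) < m := fun m =>
    Finset.filter_congr fun i _ => by simp
  rw [Grenet.adjugate_one_sub (Grenet.wt k n) (grenet_adj_shape k n), Matrix.sum_apply, map_sum,
    Finset.sum_eq_single_of_mem S.card (Finset.mem_range.mpr (by omega))]
  · rw [evalWord_grenet_adj_pow k r ∅ S (by rw [Finset.card_empty]; omega), hfilt]
    simp only [Finset.notMem_empty, not_false_eq_true, implies_true, true_and, Finset.empty_union]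
    by_cases h : (univ.filter fun i : Fin n => (i : ℕ) < S.card).image r = S
    · have hinj : Function.Injective (fun t : Fin S.card => r ⟨(∅ : Finset (Fin n)).card + (t : ℕ), by
          rw [Finset.card_empty]; omega⟩) := by
        rw [injective_iff_card_image_eq, image_word_shift r (by rw [Finset.card_empty]; omega), hfilt, h]
      rw [if_pos h, if_pos ⟨hinj, h⟩]
    · rw [if_neg h, if_neg fun h' => h h'.2]
  · intro m hm hne
    rw [eval_grenet_adj_pow]
    refine Finset.sum_eq_zero fun g _ => if_neg ?_
    rintro ⟨hg, hgS, hST⟩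
    have h := card_eq_of_pathCondition hg hgS hST
    rw [Finset.card_empty, zero_add] at h
    exact hne h.symm

/-- **The sink row of the path matrix at a word point**: for `|T| ≤ n`,
`eval (W T univ) = [t ↦ r(|T|+t) injective, avoids T, and T ∪ r({c ≥ |T|}) = univ]`. [folklore] -/
theorem evalWord_grenet_W_univ (r : Fin n → Fin n) (T : Finset (Fin n)) (hT : T.card ≤ n) :
    eval (fun v : Fin n × Fin n => if r v.2 = v.1 then (1 : k) else 0) ((1 - Grenet.adj k n).adjugate T univ)
      = if Function.Injective (fun t : Fin (n - T.card) => r ⟨T.card + (t : ℕ), by omega⟩) ∧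
            (∀ t : Fin (n - T.card), r ⟨T.card + (t : ℕ), by omega⟩ ∉ T) ∧
            T ∪ (univ.filter fun i : Fin n => T.card ≤ (i : ℕ)).image r = univ
        then 1 else 0 := by
  have hfilt : (univ.filter fun i : Fin n => T.card ≤ (i : ℕ) ∧ (i : ℕ) < T.card + (n - T.card))
      = univ.filter fun i : Fin n => T.card ≤ (i : ℕ) :=
    Finset.filter_congr fun i _ => by constructor; exact fun h => h.1; exact fun h => ⟨h, by omega⟩
  rw [Grenet.adjugate_one_sub (Grenet.wt k n) (grenet_adj_shape k n), Matrix.sum_apply, map_sum,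
    Finset.sum_eq_single_of_mem (n - T.card) (Finset.mem_range.mpr (by omega))]
  · rw [evalWord_grenet_adj_pow k r T univ (by omega), hfilt]
  · intro m hm hne
    rw [eval_grenet_adj_pow]
    refine Finset.sum_eq_zero fun g _ => if_neg ?_
    rintro ⟨hg, hgS, hST⟩
    have h := card_eq_of_pathCondition hg hgS hST
    rw [Finset.card_univ, Fintype.card_fin] at h
    exact hne (by omega)

end WordEval

/-! ### Counting and weights along a word -/

section Counting

variable {n : ℕ}

/-- If `r` is injective on `A` (`|r(A)| = |A|`), the number of `c ∈ A` with `r c = j` is `[j ∈ r(A)]`.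
[folklore] -/
theorem card_filter_eq_of_card_image {α : Type*} [DecidableEq α] (r : Fin n → α) (A : Finset (Fin n))
    (hA : (A.image r).card = A.card) (j : α) :
    (A.filter fun c => r c = j).card = if j ∈ A.image r then 1 else 0 := by
  have hinj : Set.InjOn r A := Finset.card_image_iff.mp hA
  by_cases hj : j ∈ A.image r
  · rw [if_pos hj]
    obtain ⟨c₀, hc₀, rfl⟩ := Finset.mem_image.mp hj
    rw [Finset.card_eq_one]
    refine ⟨c₀, Finset.eq_singleton_iff_unique_mem.mpr ⟨Finset.mem_filter.mpr ⟨hc₀, rfl⟩, fun c hc => ?_⟩⟩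
    obtain ⟨hcA, hrc⟩ := Finset.mem_filter.mp hc
    exact hinj hcA hc₀ hrc
  · rw [if_neg hj, Finset.card_eq_zero]
    refine Finset.filter_false_of_mem fun c hc h => hj ?_
    exact Finset.mem_image.mpr ⟨c, hc, h⟩

/-- **Column weight zero.** If the column component of an entry weight is identically `1`, i.e.
`[c' < a] + [b ≤ c'] + [c' = q] = 1` for all `c' < n` (with `a, b ≤ n`, `q < n`), then `b = a + 1` and
`q = a`. [folklore] -/
theorem colWeight_eq_one_imp {a b : ℕ} (ha : a ≤ n) (hb : b ≤ n) (q : Fin n)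
    (h : ∀ c' : Fin n, (if (c' : ℕ) < a then 1 else 0) + (if b ≤ (c' : ℕ) then 1 else 0)
      + (if c' = q then 1 else 0) = (1 : ℕ)) : b = a + 1 ∧ (q : ℕ) = a := by
  have hq := h q
  rw [if_pos rfl] at hq
  have h1 : ¬ (q : ℕ) < a := fun h' => by rw [if_pos h'] at hq; omega
  have h2 : ¬ b ≤ (q : ℕ) := fun h' => by rw [if_pos h'] at hq; omega
  have hqn := q.isLt
  -- if `b ≥ a + 2`, some `c' ≠ q` lies in `[a, b)` and has weight `0`
  by_contra hcon
  have hab : a + 2 ≤ b := by omega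
  obtain ⟨c', hc'q, hc'a, hc'b⟩ : ∃ c' : Fin n, c' ≠ q ∧ a ≤ (c' : ℕ) ∧ (c' : ℕ) < b := by
    by_cases hqa : (q : ℕ) = a
    · exact ⟨⟨a + 1, by omega⟩, fun h' => by rw [Fin.ext_iff] at h'; simp only at h'; omega, by simp, by simp only; omega⟩
    · exact ⟨⟨a, by omega⟩, fun h' => by rw [Fin.ext_iff] at h'; simp only at h'; omega, by simp, by simp only; omega⟩
  have hc := h c'
  rw [if_neg (by omega), if_neg (by omega), if_neg hc'q] at hc
  omega

/-- **The entries read along a word have the word's weight.** For a word `r` and a valid split `s`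
(`|r({c<s})| = s`, `|r({c>s})| = n - 1 - s`), the indicator entry weight of
`(r({c<s}), r({c>s})ᶜ, (r s, s))` is `inl j' ↦ #{c : r c = j'}`, `inr c' ↦ 1`. [folklore] -/
theorem weightE_window (r : Fin n → Fin n) (s : Fin n)
    (hpre : ((univ.filter fun c : Fin n => (c : ℕ) < s).image r).card = s)
    (hsuf : ((univ.filter fun c : Fin n => (s : ℕ) < c).image r).card = n - 1 - s) :
    ((∑ j ∈ (univ.filter fun c : Fin n => (c : ℕ) < s).image r, (Pi.single (Sum.inl j) 1 : Fin n ⊕ Fin n → ℕ)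
        + ∑ j ∈ (((univ.filter fun c : Fin n => (s : ℕ) < c).image r)ᶜ)ᶜ, (Pi.single (Sum.inl j) 1 : Fin n ⊕ Fin n → ℕ)) +
        (∑ c ∈ univ.filter (fun c : Fin n => (c : ℕ) < ((univ.filter fun c : Fin n => (c : ℕ) < s).image r).card),
            (Pi.single (Sum.inr c) 1 : Fin n ⊕ Fin n → ℕ)
          + ∑ c ∈ univ.filter (fun c : Fin n => (((univ.filter fun c : Fin n => (s : ℕ) < c).image r)ᶜ).card ≤ (c : ℕ)),
            (Pi.single (Sum.inr c) 1 : Fin n ⊕ Fin n → ℕ))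
        + ((Pi.single (Sum.inl (r s)) 1 : Fin n ⊕ Fin n → ℕ) + (Pi.single (Sum.inr s) 1 : Fin n ⊕ Fin n → ℕ)))
      = Sum.elim (fun j : Fin n => (univ.filter fun c : Fin n => r c = j).card) (fun _ => 1) := by
  have hpre_card : (univ.filter fun c : Fin n => (c : ℕ) < s).card = s := by
    rw [Fin.card_filter_val_lt]; exact min_eq_right s.isLt.le
  have hsuf_card : (univ.filter fun c : Fin n => (s : ℕ) < c).card = n - 1 - s := by
    have : (univ.filter fun c : Fin n => (s : ℕ) < c) = (univ.filter fun c : Fin n => (c : ℕ) < s + 1)ᶜ := by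
      ext c; simp only [Finset.mem_filter, Finset.mem_univ, true_and, Finset.mem_compl]; omega
    rw [this, Finset.card_compl, Fin.card_filter_val_lt, Fintype.card_fin]
    omega
  have hcomplcard : (((univ.filter fun c : Fin n => (s : ℕ) < c).image r)ᶜ).card = s + 1 := by
    rw [Finset.card_compl, hsuf, Fintype.card_fin]; have := s.isLt; omega
  funext x
  cases x with
  | inl j' =>
    rw [weightE_apply_inl (S := (univ.filter fun c : Fin n => (c : ℕ) < s).image r)
      (T := ((univ.filter fun c : Fin n => (s : ℕ) < c).image r)ᶜ) (v := (r s, s)) j']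
    simp only [Sum.elim_inl, Finset.mem_compl]
    -- split the count over `c < s`, `c = s`, `c > s`
    have hsplit : (univ.filter fun c : Fin n => r c = j') =
        ((univ.filter fun c : Fin n => (c : ℕ) < s).filter fun c => r c = j') ∪
        (((univ.filter fun c : Fin n => (s : ℕ) < c).filter fun c => r c = j') ∪
          ({s} : Finset (Fin n)).filter fun c => r c = j') := by
      ext c
      simp only [Finset.mem_filter, Finset.mem_univ, true_and, Finset.mem_union, Finset.mem_singleton]
      constructor
      · intro h
        rcases lt_trichotomy (c : ℕ) s with h' | h' | h'
        · exact Or.inl ⟨h', h⟩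
        · exact Or.inr (Or.inr ⟨Fin.ext h', h⟩)
        · exact Or.inr (Or.inl ⟨h', h⟩)
      · rintro (⟨-, h⟩ | ⟨-, h⟩ | ⟨-, h⟩) <;> exact h
    rw [hsplit, Finset.card_union_of_disjoint, Finset.card_union_of_disjoint,
      card_filter_eq_of_card_image r _ (hpre.trans hpre_card.symm),
      card_filter_eq_of_card_image r _ (hsuf.trans hsuf_card.symm), Finset.filter_singleton]
    · simp only [eq_comm (a := j') (b := r s)]
      clear hsplit hpre hsuf hpre_card hsuf_card hcomplcard
      split_ifs <;> simp_all
    · exact Finset.disjoint_left.mpr fun c h1 h2 => by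
        simp only [Finset.mem_filter, Finset.mem_univ, true_and, Finset.mem_singleton] at h1 h2
        rw [h2.1] at h1; exact lt_irrefl _ h1.1
    · exact Finset.disjoint_left.mpr fun c h1 h2 => by
        simp only [Finset.mem_filter, Finset.mem_univ, true_and, Finset.mem_union, Finset.mem_singleton] at h1 h2
        rcases h2 with ⟨h2, -⟩ | ⟨h2, -⟩
        · omega
        · rw [h2] at h1; exact lt_irrefl _ h1.1
  | inr c' =>
    rw [weightE_apply_inr (S := (univ.filter fun c : Fin n => (c : ℕ) < s).image r)
      (T := ((univ.filter fun c : Fin n => (s : ℕ) < c).image r)ᶜ) (v := (r s, s)) c', hpre, hcomplcard]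
    simp only [Sum.elim_inr]
    by_cases h1 : (c' : ℕ) < s
    · rw [if_pos h1, if_neg (by omega), if_neg (fun h => by rw [h] at h1; exact lt_irrefl _ h1)]
    · by_cases h2 : c' = s
      · subst h2; rw [if_neg h1, if_neg (by omega), if_pos rfl]
      · have : (c' : ℕ) ≠ s := fun h => h2 (Fin.ext h)
        rw [if_neg h1, if_pos (by omega), if_neg h2]

end Counting

end Summit.ValiantsHypothesis.Theorems.RigidityForcesSymmetry.GrenetGauge
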